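import Summits.QuantumFields.YangMills.Theorems.BalabanUVNodesN06AtRecord11ObligationsPins4
import Literature.MathematicalPhysics.QuantumFieldTheory.Balaban1983to89.B9RWSums346TwoGp

/-!
# BalabanUVNodes ∕ N06 ([B9], `Dag.B9_main`) — OBLIGATIONS OF THE STAGE-11 CERTIFICATE KNIT AT THE RECORD, XI-h: `t310` AND `t37` AT THE ALL-BLOCKS PINS WITH EVERY MEMBER OF
# THEOREMS 3.3 ∕ 3.1 PROVED INSIDE THE LEAVES — NO DISPLAYED RESIDUAL (seat n06-k's `B9RWSums346Two(Gp)` over `…344Input(Gp)` ∕ `…346Lap` ∕ `…343Holder(Gp)` ∕ `…346Schur`)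

Track A of `YM-PLAN.md` (cell `pub-ymgap`, HUMAN RULING D-0062), node **N06** = [Balaban1985BackgroundPropagators] Thms 3.1–3.15; seat
`pub-ymgap-dag-n06-d` gen 3 = dag-lead N06-ASSIGNMENT v1 (P3) «THE KNIT AT THE RECORD».  Companion of `…ObligationsPins4` … `…Pins7` (per-row lemmas at `ops : OpsY N θ₃ M⋆`).

THE POINT.  `…Pins7.t310_of_allPin_input` ∕ `t37_of_allPin_input` (rows 19 ∕ 18 at the all-blocks pins) displayed ONE line of the residual: the two-sided L² member (3.46)₄
‖h∇_UG∇*_UJ‖ ∕ ‖h∇_UG′∇*_Uλ‖.  Seat n06-k's `B9RWSums346Two.thm310Printed_allPin_complete` and `B9RWSums346TwoGp.thm37Printed_allPin_complete` PROVE it inside the leaves in r1's block-L²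
calculus (`B9SectDL2Decay.BlockBd` ≡ `B11SectG.HasMaj` between unweighted L² block norms): by (3.106) ∇_UG∇*_U = ∇_UG₀∇*_U + (∇_UG)(R∇*_U) — L² head legs (`L2TwoLegs310` ∕ `L2TwoLegs37`,
Cor. 3.6's two-sided (3.46) line for h_□G_□h_□, POSITED) plus ONE composition of the sibling's L² bound of ∇_UG (Schur from the pin + transpose letter) with the factors' L² bounds
R_a∇*_U carrying (L^jη)⁻¹ (`FactorsL2_310` ∕ `FactorsL2_37`, p. 413, POSITED), p. 398's transfer and [4] (2.61) — so that the leaves `B9.Thm310Printed … (W310OfOps … (ConvAll3107 …))` and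
`B9.Thm37Printed … (E37AllOfOps …)` carry NO `hrest` binder: EVERY member of the typed (3.42)–(3.47) block for the kernel families read from the sums is proved inside from operator-level
hypothesis schemas of printed ∕ located shape.

WHAT THIS MODULE DOES (kernel bookkeeping; 0 `def`, 0 `sorry`, standard axioms; COUNT-NEUTRAL, `--supports` K1′ `StabilityBAtRecordR12e`), at `I := MemberY`, `geo9Y`, `bg9Y (M_N ℂ) SU(N)`,
`c35Y`: ★ `t310_of_allPin_complete`, ★ `t37_of_allPin_complete` — `B9.Thm310Printed … (fun x => (ops x).E310)` ∕ `B9.Thm37Printed … (fun x => (ops x).E37)` at the all-blocks pins from the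
inputs of `…Pins7.t310∕t37_of_allPin_input` WITHOUT `hrest`, PLUS the two-sided-leg supports `S2` with count `N2`, constants `B2 θ2` with `hB4 : twoConst d δ₀ α N2 B2 (N_F ∕ N′) θ2 C L₀ ≤ B₁`,
the co-reading `hl4` of the line n = 4 by ∇_U∘G∘∇*_U, the rate relations `hδ₁ : δ₁ ≤ (1 − 2α_F)·δ` (was (1 − α_F)·δ) and `hαF2 : α_F ≤ ½` (for n06-k's `2α·δ ≤ δ`), and ONE operator-level
package `h36H` = Hölder legs ∧ probe-read factors (resp. V-terms) ∧ Laplacian legs ∧ input legs ∧ input-read factors ∧ two-sided L² legs ∧ L² factors at `h36`'s thresholds `M₁ a₁` and rate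
`δ₀` (n06-k's parameters `d₁ := d`, `δ₁ := δ₀`, `α₁ := α` as in Pins5–7).

HONEST FRAMING.  Kernel bookkeeping at pinned readings over displayed hypothesis schemas of printed ∕ located shape; nothing of [B9] is proved for Bałaban's operators; N06 is
NOT discharged.  One finite four-torus programme at fixed `ε` — NOT ℝ⁴, NOT OS, NOT a mass gap, NOT Clay.  No `def`.
-/






noncomputable section

namespace Summit.QuantumFields.YangMills.BalabanUVNodes.N06AtRecord11ObligationsPins8

open Literature.MathematicalPhysics.QuantumFieldTheory.Balaban1983to89
open Literature.MathematicalPhysics.QuantumFieldTheory.Balaban1983to89.Node00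
open Literature.MathematicalPhysics.QuantumFieldTheory.Balaban1983to89.B9PinMembersKLevelV1 (MemberY geo9Y bg9Y)
open Literature.MathematicalPhysics.QuantumFieldTheory.Balaban1983to89.B9PinGeometryKLevelV1 (c35Y c35Y_pos)
open Literature.MathematicalPhysics.QuantumFieldTheory.Balaban1983to89.B7Prop2SpecialUnitary (specialUnitaryUnits)
open Literature.MathematicalPhysics.QuantumFieldTheory.Balaban1983to89.B9Thm34Ext (toB6)
open Literature.MathematicalPhysics.QuantumFieldTheory.Balaban1983to89.B6RandomWalk (Ineq261)
open Literature.MathematicalPhysics.QuantumFieldTheory.Balaban1983to89.B9Thm37Whole (Ops Sizes StaticOK Local342 Identities const37)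
open Literature.MathematicalPhysics.QuantumFieldTheory.Balaban1983to89.B9Cor38Whole
open Literature.MathematicalPhysics.QuantumFieldTheory.Balaban1983to89.B9Thm37GlueCor36 (CoRealizes)
open Literature.MathematicalPhysics.QuantumFieldTheory.Balaban1983to89.B9Thm37Glue (IsTransposePair)
open Literature.MathematicalPhysics.QuantumFieldTheory.Balaban1983to89.B9Thm310Whole
open Literature.MathematicalPhysics.QuantumFieldTheory.Balaban1983to89.B9RWSums343to347Whole
open Literature.MathematicalPhysics.QuantumFieldTheory.Balaban1983to89.B9RWSums346Schur (L2Reads thm310Printed_allPin_schur thm37Printed_allPin_schur)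
open Literature.MathematicalPhysics.QuantumFieldTheory.Balaban1983to89.B9GeoLemma21KLevelV1 (geo9Y_dist_comm geo9Y_len_pos)
open Literature.MathematicalPhysics.QuantumFieldTheory.Balaban1983to89.B9GeoNormsKLevelV1 (geo9K_dist_nonneg)
open Summit.QuantumFields.YangMills.BalabanUVNodes.N06AtRecord11Obligations (const37_nonneg)
open scoped Matrix.Norms.L2Operator
open Literature.MathematicalPhysics.QuantumFieldTheory.Balaban1983to89.B9RWSums343Holder
  (HolderProbes H1Reads HolderLegs310 FactorsHolder310 holderConst)
open Literature.MathematicalPhysics.QuantumFieldTheory.Balaban1983to89.B9RWSums343HolderGp (HolderLegs37 HolderV37)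
open Literature.MathematicalPhysics.QuantumFieldTheory.Balaban1983to89.B9RWSums346Lap (LapLegs310 LapLegs37 lapConst)
open Literature.MathematicalPhysics.QuantumFieldTheory.Balaban1983to89.B9RWSums344InputGp (InputLegs37 FactorsInput37)
open Literature.MathematicalPhysics.QuantumFieldTheory.Balaban1983to89.B9RWSums346Two (L2TwoLegs310 FactorsL2_310 twoConst thm310Printed_allPin_complete)
open Literature.MathematicalPhysics.QuantumFieldTheory.Balaban1983to89.B9RWSums346TwoGp (L2TwoLegs37 FactorsL2_37 thm37Printed_allPin_complete)
open Literature.MathematicalPhysics.QuantumFieldTheory.Balaban1983to89.B9RWSums344Input (InputReads InputLegs310 FactorsInput310 inputConst44 inputConst45)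
open Literature.MathematicalPhysics.QuantumFieldTheory.Balaban1983to89.B11SectG (BlockNorm)

variable {N : ℕ} (θ₃ : Stage3Params) (Mstar : ℕ) (ops : OpsY N θ₃ Mstar)

/-- ★ **`t310` AT THE ALL-BLOCKS PIN, EVERY MEMBER PROVED INSIDE, NO RESIDUAL** `(ops x).E310 = W310OfOps (𝔬 x) (rd x) (ConvAll3107 (𝔬 x) (R x) (H x) C δ (ops x).GA B₁ δ₁ …)` (C = `const37 …`,
δ = (1−2α)δ₀): n06-k's inputs give Theorem 3.10 at `W310OfOps … (Conv3107 …)` (`thm310Printed_of_local3107`), and `thm310Printed_allPin_complete` strengthens the predicate from the co-readings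
of `(ops x).GA` (sup ∕ weighted ∕ all six L² lines ∕ Hölder-through-probes ∕ input through `bH`), the symmetry of G(U), the transpose pair and the transpose letter `hadjL`, `Facts347` (M ≧ M_g; at
rate δ₀ for M ≧ M_F), Cor. 3.6's Hölder legs, probe-read factors, Laplacian legs, input legs, input-read factors, two-sided L² legs and L² factors (`h36H`) and the constants' relations (`hBβ`,
`hB5`, `hBε`, `hBεβ`, `hB4`) — displayed; NO `hrest`.
[cite: Balaban1985BackgroundPropagators, Thm 3.10 (3.105)–(3.108) pp.413–416, Thm 3.10 ⇒ Thm 3.3 p.416, Cor. 3.6 p.408, (3.40) p.397, (3.42)–(3.47) pp.397–398; Balaban1984PropagatorsII, Lemma 2.1 (2.60)–(2.61) p.234, (2.52)–(2.55) p.232] -/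
theorem t310_of_allPin_complete [∀ x : MemberY θ₃.d₆ θ₃.ℓ₆ θ₃.hd' θ₃.hL' θ₃.b₀ θ₃.b₁ Mstar, Fintype (geo9Y x).Site] [∀ x : MemberY θ₃.d₆ θ₃.ℓ₆ θ₃.hd' θ₃.hL' θ₃.b₀ θ₃.b₁ Mstar, DecidableEq (geo9Y x).Site]
    {X Y ι A PX PY : MemberY θ₃.d₆ θ₃.ℓ₆ θ₃.hd' θ₃.hL' θ₃.b₀ θ₃.b₁ Mstar → Type} [∀ x, Fintype (X x)] [∀ x, DecidableEq (X x)] [∀ x, Fintype (Y x)]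
    [∀ x, DecidableEq (Y x)] [∀ x, Fintype (ι x)] [∀ x, Fintype (A x)] [∀ x, Fintype (PX x)] [∀ x, DecidableEq (PX x)] [∀ x, Fintype (PY x)] [∀ x, DecidableEq (PY x)]
    (𝔬 : ∀ x : MemberY θ₃.d₆ θ₃.ℓ₆ θ₃.hd' θ₃.hL' θ₃.b₀ θ₃.b₁ Mstar, Ops310 (geo9Y x) (bg9Y (Matrix (Fin N) (Fin N) ℂ) (specialUnitaryUnits (Fin N)) x) (X x) (Y x) (ι x) (A x))
    (rd : ∀ x : MemberY θ₃.d₆ θ₃.ℓ₆ θ₃.hd' θ₃.hL' θ₃.b₀ θ₃.b₁ Mstar, WalkReading310 (geo9Y x) (bg9Y (Matrix (Fin N) (Fin N) ℂ) (specialUnitaryUnits (Fin N)) x) (X x) (ι x) (A x))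
    (𝔭 : ∀ x : MemberY θ₃.d₆ θ₃.ℓ₆ θ₃.hd' θ₃.hL' θ₃.b₀ θ₃.b₁ Mstar, HolderProbes (geo9Y x) (bg9Y (Matrix (Fin N) (Fin N) ℂ) (specialUnitaryUnits (Fin N)) x) (X x) (Y x) (PX x) (PY x))
    (SH SL SI S2 : ∀ x : MemberY θ₃.d₆ θ₃.ℓ₆ θ₃.hd' θ₃.hL' θ₃.b₀ θ₃.b₁ Mstar, ι x → Finset (geo9Y x).Site) (Bl θH BI θI : ℝ → ℝ) (BI2 : ℝ → ℝ → ℝ) (NH NL BL MF NI N2 B2 θ2 : ℝ) (dL : ℕ)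
    (R : MemberY θ₃.d₆ θ₃.ℓ₆ θ₃.hd' θ₃.hL' θ₃.b₀ θ₃.b₁ Mstar → ℝ) (H : MemberY θ₃.d₆ θ₃.ℓ₆ θ₃.hd' θ₃.hL' θ₃.b₀ θ₃.b₁ Mstar → Prop) (κ : MemberY θ₃.d₆ θ₃.ℓ₆ θ₃.hd' θ₃.hL' θ₃.b₀ θ₃.b₁ Mstar → Sizes310)
    (bH : ∀ x : MemberY θ₃.d₆ θ₃.ℓ₆ θ₃.hd' θ₃.hL' θ₃.b₀ θ₃.b₁ Mstar, ℝ → BlockNorm (toB6 (geo9Y x) (R x) (H x)) (Y x → ℝ))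
    (d : ℕ) (α ρ Nc N' NF Cℓ K θ₀ B₀ δ₀ a₁ M₁ ML : ℝ)
    (hα : 0 ≤ α) (hα2 : α ≤ 1 / 2) (hN : 0 ≤ Nc) (hN' : 0 ≤ N') (hNF : 0 ≤ NF) (hCℓ : 1 ≤ Cℓ) (hK : 0 ≤ K) (hθ₀ : 0 ≤ θ₀) (hB₀ : 0 < B₀)
    (hδ₀ : 0 < δ₀) (ha₁ : 0 < a₁) (hM₁ : 0 < M₁) (hNH : 0 ≤ NH) (hNL : 0 ≤ NL) (hBL : 0 ≤ BL) (hNI : 0 ≤ NI) (hN2 : 0 ≤ N2) (hB2 : 0 ≤ B2) (hθ2 : 0 ≤ θ2)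
    (hst : ∀ x, StaticOK310 (𝔬 x) ρ Nc N' NF Cℓ (κ x)) (hκ : ∀ x, (κ x).Bounded K)
    (hrd : ∀ x, (rd x).OK (𝔬 x).blk) (hloc : ∀ x, Locality310 (𝔬 x) (rd x))
    (h261 : ∀ x : MemberY θ₃.d₆ θ₃.ℓ₆ θ₃.hd' θ₃.hL' θ₃.b₀ θ₃.b₁ Mstar, ML ≤ (geo9Y x).M → Ineq261 d (toB6 (geo9Y x) (R x) (H x)) δ₀ α)
    (h36 : ∀ x : MemberY θ₃.d₆ θ₃.ℓ₆ θ₃.hd' θ₃.hL' θ₃.b₀ θ₃.b₁ Mstar, M₁ ≤ (geo9Y x).M → ∀ α₀ : ℝ, 0 < α₀ → c35Y * (geo9Y x).M * α₀ ≤ a₁ →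
      ∀ U : (bg9Y (Matrix (Fin N) (Fin N) ℂ) (specialUnitaryUnits (Fin N)) x).Cfg, (bg9Y (Matrix (Fin N) (Fin N) ℂ) (specialUnitaryUnits (Fin N)) x).Reg335 c35Y α₀ U →
        Local342G (𝔬 x) (R x) (H x) B₀ δ₀ U ∧ Factors389 (𝔬 x) (R x) (H x) θ₀ δ₀ U ∧ Identities310 (𝔬 x) (R x) (H x) U)
    (h36H : ∀ x : MemberY θ₃.d₆ θ₃.ℓ₆ θ₃.hd' θ₃.hL' θ₃.b₀ θ₃.b₁ Mstar, M₁ ≤ (geo9Y x).M → ∀ α₀ : ℝ, 0 < α₀ → c35Y * (geo9Y x).M * α₀ ≤ a₁ →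
      ∀ U : (bg9Y (Matrix (Fin N) (Fin N) ℂ) (specialUnitaryUnits (Fin N)) x).Cfg, (bg9Y (Matrix (Fin N) (Fin N) ℂ) (specialUnitaryUnits (Fin N)) x).Reg335 c35Y α₀ U →
        HolderLegs310 (𝔬 x) (𝔭 x) (R x) (H x) (SH x) Bl δ₀ U ∧ FactorsHolder310 (𝔬 x) (𝔭 x) (R x) (H x) θH δ₀ U ∧ LapLegs310 (𝔬 x) (R x) (H x) (SL x) BL δ₀ U ∧
          InputLegs310 (𝔬 x) (𝔭 x) (R x) (H x) (bH x) (SI x) BI BI2 δ₀ U ∧ FactorsInput310 (𝔬 x) (R x) (H x) (bH x) θI δ₀ U ∧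
          L2TwoLegs310 (𝔬 x) (R x) (H x) (S2 x) B2 δ₀ U ∧ FactorsL2_310 (𝔬 x) (R x) (H x) θ2 δ₀ U)
    (hcntH : ∀ (x : MemberY θ₃.d₆ θ₃.ℓ₆ θ₃.hd' θ₃.hL' θ₃.b₀ θ₃.b₁ Mstar) (a : (geo9Y x).Site), (∑ q, if a ∈ SH x q then (1 : ℝ) else 0) ≤ NH)
    (hcntL : ∀ (x : MemberY θ₃.d₆ θ₃.ℓ₆ θ₃.hd' θ₃.hL' θ₃.b₀ θ₃.b₁ Mstar) (a : (geo9Y x).Site), (∑ q, if a ∈ SL x q then (1 : ℝ) else 0) ≤ NL)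
    (hcntI : ∀ (x : MemberY θ₃.d₆ θ₃.ℓ₆ θ₃.hd' θ₃.hL' θ₃.b₀ θ₃.b₁ Mstar) (a : (geo9Y x).Site), (∑ q, if a ∈ SI x q then (1 : ℝ) else 0) ≤ NI)
    (hcnt2 : ∀ (x : MemberY θ₃.d₆ θ₃.ℓ₆ θ₃.hd' θ₃.hL' θ₃.b₀ θ₃.b₁ Mstar) (a : (geo9Y x).Site), (∑ q, if a ∈ S2 x q then (1 : ℝ) else 0) ≤ N2)
    (hBl : ∀ β, 0 ≤ β → β < 1 → 0 ≤ Bl β) (hθH : ∀ β, 0 ≤ β → β < 1 → 0 ≤ θH β) (hBI : ∀ ε, 0 < ε → ε ≤ 1 → 0 ≤ BI ε)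
    (hBI2 : ∀ ε β, 0 < ε → ε ≤ 1 → 0 ≤ β → β < 1 → 0 ≤ BI2 ε β) (hθI : ∀ ε, 0 < ε → 0 ≤ θI ε)
    (ev : ∀ x : MemberY θ₃.d₆ θ₃.ℓ₆ θ₃.hd' θ₃.hL' θ₃.b₀ θ₃.b₁ Mstar, (geo9Y x).Loc → X x → ℝ) (evY : ∀ x : MemberY θ₃.d₆ θ₃.ℓ₆ θ₃.hd' θ₃.hL' θ₃.b₀ θ₃.b₁ Mstar, (geo9Y x).Loc → Y x → ℝ)
    (hco0 : ∀ x U, CoRealizes (ops x).GA 0 U (𝔬 x).blk (𝔬 x).blk (ev x) ((𝔬 x).G U))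
    (hco1 : ∀ x U, CoRealizes (ops x).GA 1 U (𝔬 x).blkY (𝔬 x).blk (ev x) ((𝔬 x).D U ∘ₗ (𝔬 x).G U))
    (hco2 : ∀ x U, CoRealizes (ops x).GA 2 U (𝔬 x).blk (𝔬 x).blkY (evY x) ((𝔬 x).G U ∘ₗ (𝔬 x).Dstar U))
    (hco3 : ∀ x U, CoRealizes (ops x).GA 3 U (𝔬 x).blk (𝔬 x).blk (ev x) ((𝔬 x).Lap U ∘ₗ (𝔬 x).G U))
    (hgl0 : ∀ x U, GlobReads (ops x).GA 0 U (𝔬 x).blk (𝔬 x).blk (ev x) ((𝔬 x).G U))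
    (hgl1 : ∀ x U, GlobReads (ops x).GA 1 U (𝔬 x).blkY (𝔬 x).blk (ev x) ((𝔬 x).D U ∘ₗ (𝔬 x).G U))
    (hgl2 : ∀ x U, GlobReads (ops x).GA 2 U (𝔬 x).blk (𝔬 x).blkY (evY x) ((𝔬 x).G U ∘ₗ (𝔬 x).Dstar U))
    (hgl3 : ∀ x U, GlobReads (ops x).GA 3 U (𝔬 x).blk (𝔬 x).blk (ev x) ((𝔬 x).Lap U ∘ₗ (𝔬 x).G U))
    (hl0 : ∀ x U, L2Reads (R := R x) (H := H x) (ops x).GA 0 U (𝔬 x).blk (𝔬 x).blk (ev x) ((𝔬 x).G U))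
    (hl1 : ∀ x U, L2Reads (R := R x) (H := H x) (ops x).GA 1 U (𝔬 x).blkY (𝔬 x).blk (ev x) ((𝔬 x).D U ∘ₗ (𝔬 x).G U))
    (hl2 : ∀ x U, L2Reads (R := R x) (H := H x) (ops x).GA 2 U (𝔬 x).blk (𝔬 x).blkY (evY x) ((𝔬 x).G U ∘ₗ (𝔬 x).Dstar U))
    (hl3 : ∀ x U, L2Reads (R := R x) (H := H x) (ops x).GA 3 U (𝔬 x).blk (𝔬 x).blk (ev x) ((𝔬 x).Lap U ∘ₗ (𝔬 x).G U))
    (hl4 : ∀ x U, L2Reads (R := R x) (H := H x) (ops x).GA 4 U (𝔬 x).blkY (𝔬 x).blkY (evY x) ((𝔬 x).D U ∘ₗ ((𝔬 x).G U ∘ₗ (𝔬 x).Dstar U)))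
    (hl5 : ∀ x U, L2Reads (R := R x) (H := H x) (ops x).GA 5 U (𝔬 x).blk (𝔬 x).blk (ev x) ((𝔬 x).G U ∘ₗ (𝔬 x).Lap U))
    (hH1 : ∀ x U, H1Reads (ops x).GA U (𝔭 x) (𝔬 x).blk (𝔬 x).blkY (ev x) (evY x) ((𝔬 x).D U ∘ₗ (𝔬 x).G U) ((𝔬 x).G U ∘ₗ (𝔬 x).Dstar U))
    (hIR : ∀ x U, InputReads (ops x).GA U (𝔭 x) (bH x) (𝔬 x).blkY (evY x) ((𝔬 x).D U ∘ₗ ((𝔬 x).G U ∘ₗ (𝔬 x).Dstar U)))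
    (hsym : ∀ x U, IsTransposePair ((𝔬 x).G U) ((𝔬 x).G U))
    (htr : ∀ x U, IsTransposePair ((𝔬 x).D U ∘ₗ (𝔬 x).G U) ((𝔬 x).G U ∘ₗ (𝔬 x).Dstar U))
    (hadjL : ∀ x U, IsTransposePair ((𝔬 x).Lap U ∘ₗ (𝔬 x).G U) ((𝔬 x).G U ∘ₗ (𝔬 x).Lap U))
    {dF : ℕ} {αF L₀ B₁ δ₁ Mg : ℝ} {Bβ Bε : ℝ → ℝ} {Bεβ : ℝ → ℝ → ℝ}
    (hfacts : ∀ x : MemberY θ₃.d₆ θ₃.ℓ₆ θ₃.hd' θ₃.hL' θ₃.b₀ θ₃.b₁ Mstar, Mg ≤ (geo9Y x).M → Facts347 (geo9Y x) (R x) (H x) dF ((1 - 2 * α) * δ₀) αF L₀)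
    (hCB : (const37 d δ₀ α ρ B₀ Nc N' Cℓ K) ≤ B₁) (hCL : (const37 d δ₀ α ρ B₀ Nc N' Cℓ K) * L₀ ≤ B₁) (hδ₁ : δ₁ ≤ (1 - 2 * αF) * ((1 - 2 * α) * δ₀)) (hαF : 0 ≤ αF * ((1 - 2 * α) * δ₀))
    (hαF2 : αF ≤ 1 / 2)
    (hCg : (const37 d δ₀ α ρ B₀ Nc N' Cℓ K) * B6.c1 dF ((1 - 2 * α) * δ₀) (1 - αF) * L₀ ^ (4 : ℝ) ≤ B₁)
    (hBβ : ∀ β, 0 ≤ β → β < 1 → holderConst d δ₀ α NH NF (const37 d δ₀ α ρ B₀ Nc N' Cℓ K) (Bl β) (θH β) ≤ Bβ β)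
    (hB5 : Real.sqrt ((const37 d δ₀ α ρ B₀ Nc N' Cℓ K) * lapConst d δ₀ α NL BL L₀) * L₀ ≤ B₁)
    (hfacts₀ : ∀ x : MemberY θ₃.d₆ θ₃.ℓ₆ θ₃.hd' θ₃.hL' θ₃.b₀ θ₃.b₁ Mstar, MF ≤ (geo9Y x).M → Facts347 (geo9Y x) (R x) (H x) dL δ₀ α L₀)
    (hBε : ∀ ε, 0 < ε → ε ≤ 1 → inputConst44 d δ₀ α NI NF (const37 d δ₀ α ρ B₀ Nc N' Cℓ K) L₀ (BI ε) (θI ε) ≤ Bε ε)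
    (hBεβ : ∀ ε β, 0 < ε → ε ≤ 1 → 0 ≤ β → β < 1 →
      inputConst45 d δ₀ α NI NF L₀ (holderConst d δ₀ α NH NF (const37 d δ₀ α ρ B₀ Nc N' Cℓ K) (Bl β) (θH β)) (BI2 ε β) (θI (β + ε)) ≤ Bεβ ε β)
    (hB4 : twoConst d δ₀ α N2 B2 NF θ2 (const37 d δ₀ α ρ B₀ Nc N' Cℓ K) L₀ ≤ B₁)
    (hE310 : ∀ x : MemberY θ₃.d₆ θ₃.ℓ₆ θ₃.hd' θ₃.hL' θ₃.b₀ θ₃.b₁ Mstar, (ops x).E310 = W310OfOps (𝔬 x) (rd x) (ConvAll3107 (𝔬 x) (R x) (H x) (const37 d δ₀ α ρ B₀ Nc N' Cℓ K) ((1 - 2 * α) * δ₀) (ops x).GA B₁ δ₁ Bβ Bε Bεβ)) :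
    B9.Thm310Printed c35Y geo9Y (bg9Y (Matrix (Fin N) (Fin N) ℂ) (specialUnitaryUnits (Fin N))) (fun x => (ops x).E310) := by
  have hfun : (fun x => (ops x).E310) = fun x => W310OfOps (𝔬 x) (rd x) (ConvAll3107 (𝔬 x) (R x) (H x) (const37 d δ₀ α ρ B₀ Nc N' Cℓ K) ((1 - 2 * α) * δ₀) (ops x).GA B₁ δ₁ Bβ Bε Bεβ) :=
    funext hE310
  rw [hfun]
  have h310 := thm310Printed_of_local3107 𝔬 rd R H κ d α ρ Nc N' NF Cℓ K θ₀ B₀ δ₀ a₁ M₁ ML c35Y_pos hα hα2 hN hN' hNF hCℓ hK hθ₀ hB₀ hδ₀ ha₁ hM₁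
    hst hκ hrd hloc h261 h36
  have hδnn : 0 ≤ (1 - 2 * α) * δ₀ := by nlinarith
  have hδ₁' : δ₁ ≤ (1 - αF) * ((1 - 2 * α) * δ₀) := by nlinarith
  have hα2' : 2 * αF * ((1 - 2 * α) * δ₀) ≤ (1 - 2 * α) * δ₀ := by nlinarith
  exact thm310Printed_allPin_complete 𝔭 bH (fun x => (ops x).GA) ev evY κ SH Bl θH d δ₀ α ρ Nc N' NF Cℓ θ₀ NH a₁ M₁ ML SL NL BL MF dL SI NI BI θI BI2 S2 N2 B2 θ2
    h310 hco0 hco1 hco2 hco3 hgl0 hgl1 hgl2 hgl3 hl0 hl1 hl2 hl3 hl4 hl5 hH1 hIR hsym htr hadjL hfacts (fun x => geo9Y_dist_comm x) (const37_nonneg d hB₀.le hN hN' hCℓ hK)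
    hCB hCL hδ₁' hδ₁ hαF hα2' hCg c35Y_pos ha₁ hα hα2 hNF hθ₀ hNH hδnn le_rfl hδ₀.le hNL hBL hNI hN2 hB2 hθ2 hB5 hB4 hst hcntH hcntL hcntI hcnt2 hBl hθH hBI hBI2
    hθI hBβ hBε hBεβ h261 hfacts₀
    (fun x hM α₀ hα₀ ha U hU => ⟨(h36 x hM α₀ hα₀ ha U hU).2.1, (h36 x hM α₀ hα₀ ha U hU).2.2, (h36H x hM α₀ hα₀ ha U hU).1, (h36H x hM α₀ hα₀ ha U hU).2.1⟩)
    (fun x hM α₀ hα₀ ha U hU => (h36H x hM α₀ hα₀ ha U hU).2.2.1) (fun x hM α₀ hα₀ ha U hU => ⟨(h36H x hM α₀ hα₀ ha U hU).2.2.2.1, (h36H x hM α₀ hα₀ ha U hU).2.2.2.2.1⟩)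
    (fun x hM α₀ hα₀ ha U hU => (h36H x hM α₀ hα₀ ha U hU).2.2.2.2.2)

/-! ## `t37` at the all-blocks pin of `E37`, every member proved inside (n06-k's G′ twin `B9RWSums346TwoGp`) -/

/-- ★ **`t37` AT THE ALL-BLOCKS PIN, EVERY MEMBER PROVED INSIDE, NO RESIDUAL** `(ops x).E37 = E37AllOfOps (W38OfOps (𝔬 x) (rd x) (R x) (H x) C δ) (𝔬 x) (R x) (H x) C δ (ops x).Gp B₁ δ₁ …`
(C = `const37 …`, δ = (1−2α)δ₀): n06-c's walk-pin inputs give Theorem 3.7 at `W38OfOps …` (`thm37Printed_W38OfOps_of_local342`), and n06-k's `thm37Printed_allPin_complete` strengthens the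
predicate to all blocks from the co-readings of `(ops x).Gp` (sup ∕ weighted ∕ all six L² lines ∕ Hölder-through-probes ∕ input through `bH`), the symmetry of G′(U), the transpose pair and the
transpose letter, `Facts347` (M ≧ M_g; at rate δ₀ for M ≧ M_F), Cor. 3.6's Hölder legs, the V-terms through the probes, the Laplacian legs, the input legs, the input-read factors, the
two-sided L² legs and L² factors (`h36H`) and the constants' relations (`hBβ`, `hB5`, `hBε`, `hBεβ`, `hB4`) — displayed; NO `hrest`.
[cite: Balaban1985BackgroundPropagators, Thm 3.7 (3.87)–(3.90) pp.408–410, Thm 3.7 ⇒ Thm 3.1 p.410, Cor. 3.6 p.408, (3.40) p.397, (3.42)–(3.47) pp.397–398; Balaban1984PropagatorsII, Lemma 2.1 (2.60)–(2.61) p.234, (2.52)–(2.55) p.232] -/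
theorem t37_of_allPin_complete [∀ x : MemberY θ₃.d₆ θ₃.ℓ₆ θ₃.hd' θ₃.hL' θ₃.b₀ θ₃.b₁ Mstar, Fintype (geo9Y x).Site] [∀ x : MemberY θ₃.d₆ θ₃.ℓ₆ θ₃.hd' θ₃.hL' θ₃.b₀ θ₃.b₁ Mstar, DecidableEq (geo9Y x).Site]
    {X Y ι PX PY : MemberY θ₃.d₆ θ₃.ℓ₆ θ₃.hd' θ₃.hL' θ₃.b₀ θ₃.b₁ Mstar → Type} [∀ x, Fintype (X x)] [∀ x, DecidableEq (X x)] [∀ x, Fintype (Y x)] [∀ x, DecidableEq (Y x)]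
    [∀ x, Fintype (ι x)] [∀ x, Fintype (PX x)] [∀ x, DecidableEq (PX x)] [∀ x, Fintype (PY x)] [∀ x, DecidableEq (PY x)]
    (𝔬 : ∀ x, Ops (geo9Y x) (bg9Y (Matrix (Fin N) (Fin N) ℂ) (specialUnitaryUnits (Fin N)) x) (X x) (Y x) (ι x)) (rd : ∀ x, WalkReading (geo9Y x) (bg9Y (Matrix (Fin N) (Fin N) ℂ) (specialUnitaryUnits (Fin N)) x) (X x) (ι x))
    (𝔭 : ∀ x : MemberY θ₃.d₆ θ₃.ℓ₆ θ₃.hd' θ₃.hL' θ₃.b₀ θ₃.b₁ Mstar, HolderProbes (geo9Y x) (bg9Y (Matrix (Fin N) (Fin N) ℂ) (specialUnitaryUnits (Fin N)) x) (X x) (Y x) (PX x) (PY x))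
    (SH SL SI S2 : ∀ x : MemberY θ₃.d₆ θ₃.ℓ₆ θ₃.hd' θ₃.hL' θ₃.b₀ θ₃.b₁ Mstar, ι x → Finset (geo9Y x).Site) (Bl BV BI θI : ℝ → ℝ) (BI2 : ℝ → ℝ → ℝ) (NH NL BL MF NI N2 B2 θ2 : ℝ) (dL : ℕ)
    (R : MemberY θ₃.d₆ θ₃.ℓ₆ θ₃.hd' θ₃.hL' θ₃.b₀ θ₃.b₁ Mstar → ℝ) (H : MemberY θ₃.d₆ θ₃.ℓ₆ θ₃.hd' θ₃.hL' θ₃.b₀ θ₃.b₁ Mstar → Prop) (κ : MemberY θ₃.d₆ θ₃.ℓ₆ θ₃.hd' θ₃.hL' θ₃.b₀ θ₃.b₁ Mstar → Sizes) (d : ℕ) (α ρ Nc N' Cℓ K θ₀ B₀ δ₀ a₁ M₁ ML : ℝ)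
    (bH : ∀ x : MemberY θ₃.d₆ θ₃.ℓ₆ θ₃.hd' θ₃.hL' θ₃.b₀ θ₃.b₁ Mstar, ℝ → BlockNorm (toB6 (geo9Y x) (R x) (H x)) (Y x → ℝ))
    (hα : 0 ≤ α) (hα2 : α ≤ 1 / 2) (hN : 0 ≤ Nc) (hN' : 0 ≤ N') (hCℓ : 1 ≤ Cℓ) (hK : 0 ≤ K) (hB₀ : 0 ≤ B₀) (hδ₀ : 0 ≤ δ₀) (ha₁ : 0 < a₁) (hM₁ : 0 < M₁)
    (hNH : 0 ≤ NH) (hNL : 0 ≤ NL) (hBL : 0 ≤ BL) (hNI : 0 ≤ NI) (hN2 : 0 ≤ N2) (hB2 : 0 ≤ B2) (hθ2 : 0 ≤ θ2)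
    (hst : ∀ x, StaticOK (𝔬 x) ρ Nc N' Cℓ (κ x)) (hκ : ∀ x, (κ x).Bounded K θ₀ Cℓ (geo9Y x).M)
    (h261 : ∀ x : MemberY θ₃.d₆ θ₃.ℓ₆ θ₃.hd' θ₃.hL' θ₃.b₀ θ₃.b₁ Mstar, ML ≤ (geo9Y x).M → Ineq261 d (toB6 (geo9Y x) (R x) (H x)) δ₀ α)
    (h36 : ∀ x : MemberY θ₃.d₆ θ₃.ℓ₆ θ₃.hd' θ₃.hL' θ₃.b₀ θ₃.b₁ Mstar, M₁ ≤ (geo9Y x).M → ∀ α₀ : ℝ, 0 < α₀ → c35Y * (geo9Y x).M * α₀ ≤ a₁ →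
      ∀ U : (bg9Y (Matrix (Fin N) (Fin N) ℂ) (specialUnitaryUnits (Fin N)) x).Cfg, (bg9Y (Matrix (Fin N) (Fin N) ℂ) (specialUnitaryUnits (Fin N)) x).Reg335 c35Y α₀ U → Local342 (𝔬 x) (R x) (H x) B₀ δ₀ U ∧ Identities (𝔬 x) (R x) (H x) U)
    (h36H : ∀ x : MemberY θ₃.d₆ θ₃.ℓ₆ θ₃.hd' θ₃.hL' θ₃.b₀ θ₃.b₁ Mstar, M₁ ≤ (geo9Y x).M → ∀ α₀ : ℝ, 0 < α₀ → c35Y * (geo9Y x).M * α₀ ≤ a₁ →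
      ∀ U : (bg9Y (Matrix (Fin N) (Fin N) ℂ) (specialUnitaryUnits (Fin N)) x).Cfg, (bg9Y (Matrix (Fin N) (Fin N) ℂ) (specialUnitaryUnits (Fin N)) x).Reg335 c35Y α₀ U →
        HolderLegs37 (𝔬 x) (𝔭 x) (R x) (H x) (SH x) Bl δ₀ U ∧ HolderV37 (𝔬 x) (𝔭 x) (R x) (H x) BV δ₀ U ∧ LapLegs37 (𝔬 x) (R x) (H x) (SL x) BL δ₀ U ∧
          InputLegs37 (𝔬 x) (𝔭 x) (R x) (H x) (bH x) (SI x) BI BI2 δ₀ U ∧ FactorsInput37 (𝔬 x) (R x) (H x) (bH x) θI δ₀ U ∧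
          L2TwoLegs37 (𝔬 x) (R x) (H x) (S2 x) B2 δ₀ U ∧ FactorsL2_37 (𝔬 x) (R x) (H x) θ2 δ₀ U)
    (hcntH : ∀ (x : MemberY θ₃.d₆ θ₃.ℓ₆ θ₃.hd' θ₃.hL' θ₃.b₀ θ₃.b₁ Mstar) (a : (geo9Y x).Site), (∑ q, if a ∈ SH x q then (1 : ℝ) else 0) ≤ NH)
    (hcntL : ∀ (x : MemberY θ₃.d₆ θ₃.ℓ₆ θ₃.hd' θ₃.hL' θ₃.b₀ θ₃.b₁ Mstar) (a : (geo9Y x).Site), (∑ q, if a ∈ SL x q then (1 : ℝ) else 0) ≤ NL)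
    (hcntI : ∀ (x : MemberY θ₃.d₆ θ₃.ℓ₆ θ₃.hd' θ₃.hL' θ₃.b₀ θ₃.b₁ Mstar) (a : (geo9Y x).Site), (∑ q, if a ∈ SI x q then (1 : ℝ) else 0) ≤ NI)
    (hcnt2 : ∀ (x : MemberY θ₃.d₆ θ₃.ℓ₆ θ₃.hd' θ₃.hL' θ₃.b₀ θ₃.b₁ Mstar) (a : (geo9Y x).Site), (∑ q, if a ∈ S2 x q then (1 : ℝ) else 0) ≤ N2)
    (hBl : ∀ β, 0 ≤ β → β < 1 → 0 ≤ Bl β) (hBV : ∀ β, 0 ≤ β → β < 1 → 0 ≤ BV β) (hBI : ∀ ε, 0 < ε → ε ≤ 1 → 0 ≤ BI ε)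
    (hBI2 : ∀ ε β, 0 < ε → ε ≤ 1 → 0 ≤ β → β < 1 → 0 ≤ BI2 ε β) (hθI : ∀ ε, 0 < ε → 0 ≤ θI ε)
    (ev : ∀ x : MemberY θ₃.d₆ θ₃.ℓ₆ θ₃.hd' θ₃.hL' θ₃.b₀ θ₃.b₁ Mstar, (geo9Y x).Loc → X x → ℝ) (evY : ∀ x : MemberY θ₃.d₆ θ₃.ℓ₆ θ₃.hd' θ₃.hL' θ₃.b₀ θ₃.b₁ Mstar, (geo9Y x).Loc → Y x → ℝ)
    (hco0 : ∀ x U, CoRealizes (ops x).Gp 0 U (𝔬 x).blk (𝔬 x).blk (ev x) ((𝔬 x).Gp U))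
    (hco1 : ∀ x U, CoRealizes (ops x).Gp 1 U (𝔬 x).blkY (𝔬 x).blk (ev x) ((𝔬 x).D U ∘ₗ (𝔬 x).Gp U))
    (hco2 : ∀ x U, CoRealizes (ops x).Gp 2 U (𝔬 x).blk (𝔬 x).blkY (evY x) ((𝔬 x).Gp U ∘ₗ (𝔬 x).Dstar U))
    (hco3 : ∀ x U, CoRealizes (ops x).Gp 3 U (𝔬 x).blk (𝔬 x).blk (ev x) ((𝔬 x).Lap U ∘ₗ (𝔬 x).Gp U))
    (hgl0 : ∀ x U, GlobReads (ops x).Gp 0 U (𝔬 x).blk (𝔬 x).blk (ev x) ((𝔬 x).Gp U))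
    (hgl1 : ∀ x U, GlobReads (ops x).Gp 1 U (𝔬 x).blkY (𝔬 x).blk (ev x) ((𝔬 x).D U ∘ₗ (𝔬 x).Gp U))
    (hgl2 : ∀ x U, GlobReads (ops x).Gp 2 U (𝔬 x).blk (𝔬 x).blkY (evY x) ((𝔬 x).Gp U ∘ₗ (𝔬 x).Dstar U))
    (hgl3 : ∀ x U, GlobReads (ops x).Gp 3 U (𝔬 x).blk (𝔬 x).blk (ev x) ((𝔬 x).Lap U ∘ₗ (𝔬 x).Gp U))
    (hl0 : ∀ x U, L2Reads (R := R x) (H := H x) (ops x).Gp 0 U (𝔬 x).blk (𝔬 x).blk (ev x) ((𝔬 x).Gp U))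
    (hl1 : ∀ x U, L2Reads (R := R x) (H := H x) (ops x).Gp 1 U (𝔬 x).blkY (𝔬 x).blk (ev x) ((𝔬 x).D U ∘ₗ (𝔬 x).Gp U))
    (hl2 : ∀ x U, L2Reads (R := R x) (H := H x) (ops x).Gp 2 U (𝔬 x).blk (𝔬 x).blkY (evY x) ((𝔬 x).Gp U ∘ₗ (𝔬 x).Dstar U))
    (hl3 : ∀ x U, L2Reads (R := R x) (H := H x) (ops x).Gp 3 U (𝔬 x).blk (𝔬 x).blk (ev x) ((𝔬 x).Lap U ∘ₗ (𝔬 x).Gp U))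
    (hl4 : ∀ x U, L2Reads (R := R x) (H := H x) (ops x).Gp 4 U (𝔬 x).blkY (𝔬 x).blkY (evY x) ((𝔬 x).D U ∘ₗ ((𝔬 x).Gp U ∘ₗ (𝔬 x).Dstar U)))
    (hl5 : ∀ x U, L2Reads (R := R x) (H := H x) (ops x).Gp 5 U (𝔬 x).blk (𝔬 x).blk (ev x) ((𝔬 x).Gp U ∘ₗ (𝔬 x).Lap U))
    (hH1 : ∀ x U, H1Reads (ops x).Gp U (𝔭 x) (𝔬 x).blk (𝔬 x).blkY (ev x) (evY x) ((𝔬 x).D U ∘ₗ (𝔬 x).Gp U) ((𝔬 x).Gp U ∘ₗ (𝔬 x).Dstar U))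
    (hIR : ∀ x U, InputReads (ops x).Gp U (𝔭 x) (bH x) (𝔬 x).blkY (evY x) ((𝔬 x).D U ∘ₗ ((𝔬 x).Gp U ∘ₗ (𝔬 x).Dstar U)))
    (hsym : ∀ x U, IsTransposePair ((𝔬 x).Gp U) ((𝔬 x).Gp U))
    (htr : ∀ x U, IsTransposePair ((𝔬 x).D U ∘ₗ (𝔬 x).Gp U) ((𝔬 x).Gp U ∘ₗ (𝔬 x).Dstar U))
    (hadjL : ∀ x U, IsTransposePair ((𝔬 x).Lap U ∘ₗ (𝔬 x).Gp U) ((𝔬 x).Gp U ∘ₗ (𝔬 x).Lap U))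
    {dF : ℕ} {αF L₀ B₁ δ₁ Mg : ℝ} {Bβ Bε : ℝ → ℝ} {Bεβ : ℝ → ℝ → ℝ}
    (hfacts : ∀ x : MemberY θ₃.d₆ θ₃.ℓ₆ θ₃.hd' θ₃.hL' θ₃.b₀ θ₃.b₁ Mstar, Mg ≤ (geo9Y x).M → Facts347 (geo9Y x) (R x) (H x) dF ((1 - 2 * α) * δ₀) αF L₀)
    (hCB : (const37 d δ₀ α ρ B₀ Nc N' Cℓ K) ≤ B₁) (hCL : (const37 d δ₀ α ρ B₀ Nc N' Cℓ K) * L₀ ≤ B₁) (hδ₁ : δ₁ ≤ (1 - 2 * αF) * ((1 - 2 * α) * δ₀)) (hαF : 0 ≤ αF * ((1 - 2 * α) * δ₀))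
    (hαF2 : αF ≤ 1 / 2)
    (hCg : (const37 d δ₀ α ρ B₀ Nc N' Cℓ K) * B6.c1 dF ((1 - 2 * α) * δ₀) (1 - αF) * L₀ ^ (4 : ℝ) ≤ B₁)
    (hBβ : ∀ β, 0 ≤ β → β < 1 → holderConst d δ₀ α NH N' (const37 d δ₀ α ρ B₀ Nc N' Cℓ K) (Bl β) (BV β) ≤ Bβ β)
    (hB5 : Real.sqrt ((const37 d δ₀ α ρ B₀ Nc N' Cℓ K) * lapConst d δ₀ α NL BL L₀) * L₀ ≤ B₁)
    (hfacts₀ : ∀ x : MemberY θ₃.d₆ θ₃.ℓ₆ θ₃.hd' θ₃.hL' θ₃.b₀ θ₃.b₁ Mstar, MF ≤ (geo9Y x).M → Facts347 (geo9Y x) (R x) (H x) dL δ₀ α L₀)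
    (hBε : ∀ ε, 0 < ε → ε ≤ 1 → inputConst44 d δ₀ α NI N' (const37 d δ₀ α ρ B₀ Nc N' Cℓ K) L₀ (BI ε) (θI ε) ≤ Bε ε)
    (hBεβ : ∀ ε β, 0 < ε → ε ≤ 1 → 0 ≤ β → β < 1 →
      inputConst45 d δ₀ α NI N' L₀ (holderConst d δ₀ α NH N' (const37 d δ₀ α ρ B₀ Nc N' Cℓ K) (Bl β) (BV β)) (BI2 ε β) (θI (β + ε)) ≤ Bεβ ε β)
    (hB4 : twoConst d δ₀ α N2 B2 N' θ2 (const37 d δ₀ α ρ B₀ Nc N' Cℓ K) L₀ ≤ B₁)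
    (hE37 : ∀ x : MemberY θ₃.d₆ θ₃.ℓ₆ θ₃.hd' θ₃.hL' θ₃.b₀ θ₃.b₁ Mstar, (ops x).E37 = E37AllOfOps (W38OfOps (𝔬 x) (rd x) (R x) (H x) (const37 d δ₀ α ρ B₀ Nc N' Cℓ K) ((1 - 2 * α) * δ₀)) (𝔬 x) (R x) (H x) (const37 d δ₀ α ρ B₀ Nc N' Cℓ K) ((1 - 2 * α) * δ₀) (ops x).Gp B₁ δ₁ Bβ Bε Bεβ) :
    B9.Thm37Printed c35Y geo9Y (bg9Y (Matrix (Fin N) (Fin N) ℂ) (specialUnitaryUnits (Fin N))) (fun x => (ops x).E37) := by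
  have hfun : (fun x => (ops x).E37) = fun x => E37AllOfOps (W38OfOps (𝔬 x) (rd x) (R x) (H x) (const37 d δ₀ α ρ B₀ Nc N' Cℓ K) ((1 - 2 * α) * δ₀)) (𝔬 x) (R x) (H x) (const37 d δ₀ α ρ B₀ Nc N' Cℓ K) ((1 - 2 * α) * δ₀) (ops x).Gp B₁ δ₁ Bβ Bε Bεβ :=
    funext hE37
  rw [hfun]
  have h37 := thm37Printed_W38OfOps_of_local342 𝔬 rd R H κ d α ρ Nc N' Cℓ K θ₀ B₀ δ₀ a₁ M₁ ML c35Y_pos hα hα2 hN hN' hCℓ hK hB₀ hδ₀ ha₁ hM₁ hst hκ h261 h36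
  have hδnn : 0 ≤ (1 - 2 * α) * δ₀ := by nlinarith
  have hCℓ0 : (0 : ℝ) ≤ Cℓ := by linarith
  have hδ₁' : δ₁ ≤ (1 - αF) * ((1 - 2 * α) * δ₀) := by nlinarith
  have hα2' : 2 * αF * ((1 - 2 * α) * δ₀) ≤ (1 - 2 * α) * δ₀ := by nlinarith
  exact thm37Printed_allPin_complete (𝔴 := fun x => (W38OfOps (𝔬 x) (rd x) (R x) (H x) (const37 d δ₀ α ρ B₀ Nc N' Cℓ K) ((1 - 2 * α) * δ₀))) 𝔭 bH (fun x => (ops x).Gp) ev evY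
    κ SH Bl BV d δ₀ α ρ Nc N' Cℓ K θ₀ B₀ NH a₁ M₁ ML SL NL BL MF dL SI NI BI θI BI2 S2 N2 B2 θ2 h37 hco0 hco1 hco2 hco3 hgl0 hgl1 hgl2 hgl3 hl0 hl1 hl2 hl3 hl4 hl5 hH1 hIR
    hsym htr hadjL hfacts (fun x => geo9Y_dist_comm x) (const37_nonneg d hB₀ hN hN' hCℓ hK) hCB hCL hδ₁' hδ₁ hαF hα2' hCg c35Y_pos ha₁ hα hα2 hN' hCℓ0 hB₀ hNH hM₁
    hδnn le_rfl hδ₀ hNL hBL hNI hN2 hB2 hθ2 hB5 hB4 hst hκ hcntH hcntL hcntI hcnt2 hBl hBV hBI hBI2 hθI hBβ hBε hBεβ h261 hfacts₀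
    (fun x hM α₀ hα₀ ha U hU => ⟨(h36 x hM α₀ hα₀ ha U hU).1, (h36 x hM α₀ hα₀ ha U hU).2, (h36H x hM α₀ hα₀ ha U hU).1, (h36H x hM α₀ hα₀ ha U hU).2.1⟩)
    (fun x hM α₀ hα₀ ha U hU => (h36H x hM α₀ hα₀ ha U hU).2.2.1) (fun x hM α₀ hα₀ ha U hU => ⟨(h36H x hM α₀ hα₀ ha U hU).2.2.2.1, (h36H x hM α₀ hα₀ ha U hU).2.2.2.2.1⟩)
    (fun x hM α₀ hα₀ ha U hU => (h36H x hM α₀ hα₀ ha U hU).2.2.2.2.2)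

end Summit.QuantumFields.YangMills.BalabanUVNodes.N06AtRecord11ObligationsPins8

end
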